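import Literature.MathematicalPhysics.QuantumFieldTheory.ChatterjeeGaussianFactorisation
import Literature.MathematicalPhysics.QuantumFieldTheory.ChatterjeeScaleComparison
import Literature.MathematicalPhysics.QuantumFieldTheory.LatticeMaxwellMultiscale
import HarnessLib

/-!
# Chatterjee's free-energy asymptotics: the bounds of §17 in free-energy-per-site form

S. Chatterjee, *The leading term of the Yang–Mills free energy*, J. Funct. Anal. 271 (2016),
arXiv:1602.01222, §17 — the two-sided bounds for the free energy per site
`F(B_n, β) = log Z(B_n, β)/n^d` of `U(N)` lattice gauge theory on the cube `B_n = {0,…,n-1}^d`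
(free boundary), in the normalised form

  `T(B_n, β) = F(B_n, β) + (|E_n^1|/(2n^d)) N² log β`     (`T`; `coef n = |E_n^1|/n^d`),

compared with the main term `G(n) = (|E_n^1|/n^d) log c_H + N² log Z_M(B_n)/n^d` (`G`; `c_H` the
Haar constant of the Cayley chart, `Z_M(B_n)` the axial-gauge lattice Maxwell partition function of
`ChatterjeeGaussianFactorisation`). This is the step between the Gaussian two-sided bounds
`ChatterjeeAssembly.logZ_le` / `le_logZ` (Lemmas 17.2/17.6 in logarithmic form) and the joint limit
`n → ∞`, `β → ∞` of Theorem 2.1 (the named fact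
`Literature.MathematicalPhysics.QuantumFieldTheory.chatterjee_freeEnergy` of `Sweep1`). Everything is
proved; no named fact is introduced.

* `Z_anti`, `logZ_anti`: the cube partition function is antitone in the cube (weights `≤ 1`);
  `F_nonpos`, `neg_C71_mul_log_le_F`, `abs_T_le`: `-C₇₁ log β ≤ F ≤ 0` (Theorem 7.1).
* `T_le_G_add` (**Lemma 17.2**, F-form): `T(B_n,β) ≤ G(n) + log 2/n^d + 67βN(2ρ₀)³d²` for `β ≥ 2`,
  `ρ₀ ≤ 1/8`.
* `F_le_mul_F`, `theta_mem`, `one_sub_theta_pow_le` (**Lemma 17.3**, cube form):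
  `F(B_n,β) ≤ (km/n)^d F(B_m,β)`, `k = ⌊n/(m+1)⌋`, `1 - (km/n)^d ≤ d(m/n + 1/(m+1))`.
* `mul_F_le_F`, `F_ge_of_ge` (**Lemma 17.5**, cube form): `F(B_n) ≥ (n'/n)^d F(B_{n'})` for
  `n ≤ n'`, and `F(B_n) ≥ (kn''/n)^d F(B_{n''}) - 2Nβ·#planes·(k/n)^d(2n''^{d-1} + (n''+1)^d - n''^d)`
  for `n'' < n`, `k = ⌊n/(n''+1)⌋ + 1`.
* `G_sub_le_T` (**Lemma 17.6**, F-form): `T(B_n,β) ≥ G(n) - (coef(n)N² log κ(r) + 67βNr³d² -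
  N² log L/n^d)` whenever `0 < L ≤ τ_n(|y_e| ≤ √β r/N ∀ e)`; the two suppliers of `L`:
  `half_le_τ` (`τ_n(‖y‖_∞ ≤ x) ≥ 1/2` for `x ≥ R_z(n)`, the union bound `gaussmax`; whence
  `G_sub_le_T_small`) and Theorem 14.3 for the special side lengths `n = ρ(m-1)+1`
  (`G_sub_le_T_special`, with the per-edge cost bound `Bcost`, `neg_Bcost_le_log_base`).

## References

* S. Chatterjee, *The leading term of the Yang–Mills free energy*, J. Funct. Anal. 271 (2016)
  2944–3005, arXiv:1602.01222, §17 (Lemmas 17.2, 17.3, 17.5, 17.6), Thm. 7.1, Thms. 14.1–14.3.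
  [arXiv160201222]
-/

noncomputable section

open MeasureTheory Measure ProbabilityTheory Finset Matrix WithLp Filter Topology
open scoped ENNReal NNReal Matrix.Norms.Frobenius
open Literature.Probability.LatticeModels Literature.MathematicalPhysics.QuantumLattice

namespace Literature.MathematicalPhysics.QuantumFieldTheory

namespace ChatterjeeJointLimit

open UnitaryCayley AxialGauge WilsonWeakCoupling GaussianToolkit LatticeMaxwell ChatterjeeAssembly
  ChatterjeeFreeEnergy

variable {d N : ℕ}

/-- Matrices. -/
local notation "𝕄" => Matrix (Fin N) (Fin N) ℂ

/-- The defining representation of `U(N)`. -/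
local notation "ι" => unitaryFundamentalRep (Fin N) ℂ

/-! ### Traces of unitary matrices -/

/-- `Re tr U ≤ N` for `U ∈ U(N)`. [folklore] -/
theorem re_trace_le (U : 𝔾 N) : ((U : 𝕄).trace).re ≤ N := by
  have h := sub_re_trace_eq U
  have : 0 ≤ ‖(1 : 𝕄) - U‖ ^ 2 / 2 := by positivity
  linarith

/-- `|Re tr U| ≤ N` for `U ∈ U(N)`. [folklore] -/
theorem abs_re_trace_le_card (U : 𝔾 N) : |((U : 𝕄).trace).re| ≤ N := by
  refine abs_le.2 ⟨?_, re_trace_le U⟩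
  have h := sub_re_trace_eq (-U)
  have h0 : 0 ≤ ‖(1 : 𝕄) - ((-U : 𝔾 N) : 𝕄)‖ ^ 2 / 2 := by positivity
  have hneg : (((-U : 𝔾 N) : 𝕄).trace).re = -((U : 𝕄).trace).re := by
    rw [show ((-U : 𝔾 N) : 𝕄) = -(U : 𝕄) from rfl, Matrix.trace_neg, Complex.neg_re]
  linarith

/-- The hypotheses of the scale-comparison lemmas for the defining representation. [folklore] -/
theorem re_trace_rep_le (U : 𝔾 N) : ((ι) U).trace.re ≤ N := by
  rw [unitaryFundamentalRep_apply]; exact re_trace_le U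

/-- `|Re tr ι(U)| ≤ N` for the defining representation. [folklore] -/
theorem abs_re_trace_rep_le (U : 𝔾 N) : |((ι) U).trace.re| ≤ N := by
  rw [unitaryFundamentalRep_apply]; exact abs_re_trace_le_card U

/-! ### The free energy per site of the cube and its normalised form -/

variable (d N) in
/-- `F(B_n, β)`, the free energy per site of the cube `B_n = {0,…,n-1}^d` for `U(N)`. [cite: arXiv160201222, §2] -/
def F (n : ℕ) (β : ℝ) : ℝ := freeEnergyPerSite (d := d) ι β (halfOpenBox d n)

variable (d) in
/-- `|E_n^1| / n^d`, twice the coefficient of `N² log β` in Theorem 2.1. [cite: arXiv160201222, Lemma 17.1] -/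
def coef (n : ℕ) : ℝ := (D₁ d n : ℝ) / (n : ℝ) ^ d

variable (d N) in
/-- The normalised free energy `F(B_n, β) + (|E_n^1|/(2n^d)) N² log β`. [cite: arXiv160201222, Thm. 2.1] -/
def T (n : ℕ) (β : ℝ) : ℝ := F d N n β + coef d n / 2 * (N : ℝ) ^ 2 * Real.log β

variable (d N) in
/-- The main term `(|E_n^1|/n^d) log c_H + N² log Z_M(B_n)/n^d`. [cite: arXiv160201222, §17] -/
def G (n : ℕ) : ℝ := coef d n * Real.log ((haarChartConst N : ℝ≥0) : ℝ) + (N : ℝ) ^ 2 * (logZM d n / (n : ℝ) ^ d)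

/-- `F(B_n, β) = log Z(B_n, β)/n^d`. [cite: arXiv160201222, §2] -/
theorem F_eq (n : ℕ) (β : ℝ) : F d N n β = logZ d N n β / (n : ℝ) ^ d := by
  rw [F, freeEnergyPerSite, card_halfOpenBox, logZ]; push_cast; rfl

/-- `D₁ = |E_n^1|`. [folklore] -/
theorem D₁_eq_card (n : ℕ) : D₁ d n = #(freeEdges d n) := card_freeIdx n

/-- **Lemma 17.1**: `|E_n^1|/n^d = d - 1 - d/n + 1/n^d`. [cite: arXiv160201222, Lemma 17.1] -/
theorem coef_eq (hd : 1 ≤ d) {n : ℕ} (hn : 1 ≤ n) :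
    coef d n = (d : ℝ) - 1 - d / n + 1 / (n : ℝ) ^ d := by
  rw [coef, D₁_eq_card, card_freeEdges hd hn]
  have hn0 : (n : ℝ) ≠ 0 := by exact_mod_cast (show n ≠ 0 by omega)
  have hpow : (n : ℝ) ^ d = n * (n : ℝ) ^ (d - 1) := by rw [← pow_succ']; congr 1; omega
  field_simp
  rw [hpow]; ring

/-- `coef ≥ 0`. [folklore] -/
theorem coef_nonneg (n : ℕ) : 0 ≤ coef d n := by unfold coef; positivity

/-- The empty cube has no free edges. [folklore] -/
theorem D₁_zero : D₁ d 0 = 0 := by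
  rw [D₁_eq_card]
  have h := card_freeEdges_le (d := d) 0
  rcases Nat.eq_zero_or_pos d with rfl | hd
  · simpa using h
  · rw [zero_pow hd.ne', mul_zero] at h; exact Nat.le_zero.1 h

/-- `|E_n^1|/n^d ≤ d`. [folklore] -/
theorem coef_le (n : ℕ) : coef d n ≤ d := by
  rcases Nat.eq_zero_or_pos n with rfl | hn
  · rw [coef, D₁_zero, Nat.cast_zero, zero_div]; exact Nat.cast_nonneg d
  · rw [coef, D₁_eq_card, div_le_iff₀ (by positivity)]
    exact_mod_cast card_freeEdges_le (d := d) n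


/-! ### Monotonicity of the partition function in the cube -/

/-- `B_m ⊆ B_n` for `m ≤ n`. [folklore] -/
theorem halfOpenBox_mono' {m n : ℕ} (h : m ≤ n) : halfOpenBox d m ⊆ halfOpenBox d n := fun x hx => by
  rw [mem_halfOpenBox] at hx ⊢
  exact fun i => ⟨(hx i).1, (hx i).2.trans_le (by exact_mod_cast h)⟩

/-- `plaquettesIn` is monotone in the region. [folklore] -/
theorem plaquettesIn_mono' {Λ Λ' : Finset (Literature.Probability.LatticeModels.Site d)} (h : Λ ⊆ Λ') :
    plaquettesIn Λ ⊆ plaquettesIn Λ' := by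
  intro p hp
  simp only [plaquettesIn, Finset.mem_filter, Finset.mem_product, Finset.mem_univ, and_true] at hp ⊢
  exact ⟨h hp.1, hp.2.1, h hp.2.2.1, h hp.2.2.2.1, h hp.2.2.2.2⟩

/-- **The cube partition function is antitone in the cube**: `Z(B_{n'}, β) ≤ Z(B_n, β)` for
`n ≤ n'` and `β ≥ 0` (more plaquettes, weights `≤ 1`). [cite: arXiv160201222, Lemma 17.3 (proof)] -/
theorem Z_anti {β : ℝ} (hβ : 0 ≤ β) {n n' : ℕ} (h : n ≤ n') : Z d N n' β ≤ Z d N n β := by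
  have hρ : Continuous (ι) := continuous_unitaryFundamentalRep (Fin N) ℂ
  show zdPartitionFunction (ι) β (halfOpenBox d n') ≤ zdPartitionFunction (ι) β (halfOpenBox d n)
  rw [zdPartitionFunction_eq_ofReal (ι) hρ β, zdPartitionFunction_eq_ofReal (ι) hρ β]
  refine ENNReal.ofReal_le_ofReal (integral_mono ?_ ?_ fun U => ?_)
  · exact AreaLaw.integrable_zdHaar_of_continuous (continuous_labelWeight (ι) hρ β _)
  · exact AreaLaw.integrable_zdHaar_of_continuous (continuous_labelWeight (ι) hρ β _)
  · exact prod_labelWeight_le_of_subset (ι) re_trace_rep_le hβ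
      (plaquettesIn_mono' (halfOpenBox_mono' h)) U

/-- `Z(B_n, β).toReal > 0` for every real `β`. [folklore] -/
theorem Z_toReal_pos' (n : ℕ) (β : ℝ) : 0 < (Z d N n β).toReal := by
  have hρ : Continuous (ι) := continuous_unitaryFundamentalRep (Fin N) ℂ
  show 0 < (zdPartitionFunction (ι) β (halfOpenBox d n)).toReal
  rw [zdPartitionFunction_toReal_eq (ι) hρ β n]
  exact FreeEnergy.zdZ_pos (ι) hρ β _

/-- `Z(B_n, β) < ∞` for `β ≥ 0`. [folklore] -/
theorem Z_ne_top {β : ℝ} (hβ : 0 ≤ β) (n : ℕ) : Z d N n β ≠ ∞ :=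
  ne_top_of_le_ne_top ENNReal.one_ne_top (Z_le_one n hβ)

/-- `log Z(B_{n'}, β) ≤ log Z(B_n, β)` for `n ≤ n'`, `β ≥ 0`. [cite: arXiv160201222, Lemma 17.3 (proof)] -/
theorem logZ_anti {β : ℝ} (hβ : 0 ≤ β) {n n' : ℕ} (h : n ≤ n') : logZ d N n' β ≤ logZ d N n β := by
  unfold logZ
  exact Real.log_le_log (Z_toReal_pos' n' β)
    ((ENNReal.toReal_le_toReal (Z_ne_top hβ n') (Z_ne_top hβ n)).2 (Z_anti hβ h))

/-! ### A priori bounds: `-C₇₁ log β ≤ F(B_n, β) ≤ 0` -/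

/-- `log Z(B_n, β) ≤ 0` for `β ≥ 0`. [cite: arXiv160201222, §17 (`F ≤ 0`)] -/
theorem logZ_nonpos {β : ℝ} (hβ : 0 ≤ β) (n : ℕ) : logZ d N n β ≤ 0 := by
  unfold logZ
  apply Real.log_nonpos (Z_toReal_pos' n β).le
  have := (ENNReal.toReal_le_toReal (Z_ne_top (d := d) (N := N) hβ n) ENNReal.one_ne_top).2 (Z_le_one n hβ)
  simpa using this

/-- `F(B_n, β) ≤ 0` for `β ≥ 0`. [cite: arXiv160201222, §17 (`F ≤ 0`)] -/
theorem F_nonpos {β : ℝ} (hβ : 0 ≤ β) (n : ℕ) : F d N n β ≤ 0 := by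
  rw [F_eq]; exact div_nonpos_of_nonpos_of_nonneg (logZ_nonpos hβ n) (by positivity)

/-- **Theorem 7.1 in F-form**: `F(B_n, β) ≥ -C₇₁ log β` for `β ≥ 2`. [cite: arXiv160201222, Thm. 7.1] -/
theorem neg_C71_mul_log_le_F {β : ℝ} (hβ : 2 ≤ β) (n : ℕ) : -(C71 d N * Real.log β) ≤ F d N n β := by
  have h := (C71_spec d N).2 n β hβ
  have hβ0 : (0 : ℝ) ≤ β := by linarith
  have h1 : Real.exp (-(C71 d N * n ^ d * Real.log β)) ≤ (Z d N n β).toReal := by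
    have := (ENNReal.toReal_le_toReal ENNReal.ofReal_ne_top (Z_ne_top hβ0 n)).2 h
    rwa [ENNReal.toReal_ofReal (Real.exp_pos _).le] at this
  have h2 : -(C71 d N * n ^ d * Real.log β) ≤ logZ d N n β := by
    rw [logZ, ← Real.log_exp (-(C71 d N * n ^ d * Real.log β))]
    exact Real.log_le_log (Real.exp_pos _) h1
  rw [F_eq]
  rcases Nat.eq_zero_or_pos n with rfl | hn
  · rcases Nat.eq_zero_or_pos d with rfl | hd
    · simp at h2 ⊢; exact h2
    · simp [zero_pow hd.ne']
      exact mul_nonneg (C71_spec d N).1.le (Real.log_nonneg (by linarith))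
  · rw [le_div_iff₀ (by positivity)]
    linarith

/-- `|F(B_n, β)| ≤ C₇₁ log β` for `β ≥ 2`. [cite: arXiv160201222, Thm. 7.1] -/
theorem abs_F_le {β : ℝ} (hβ : 2 ≤ β) (n : ℕ) : |F d N n β| ≤ C71 d N * Real.log β := by
  rw [abs_le]; exact ⟨neg_C71_mul_log_le_F hβ n, (F_nonpos (by linarith) n).trans
    (mul_nonneg (C71_spec d N).1.le (Real.log_nonneg (by linarith)))⟩

/-- `|T(B_n, β)| ≤ (C₇₁ + d N²/2) log β` for `β ≥ 2`. [folklore] -/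
theorem abs_T_le {β : ℝ} (hβ : 2 ≤ β) (n : ℕ) :
    |T d N n β| ≤ (C71 d N + d * (N : ℝ) ^ 2 / 2) * Real.log β := by
  have h1 := abs_F_le (d := d) (N := N) hβ n
  have hlog : 0 ≤ Real.log β := Real.log_nonneg (by linarith)
  have h2 : |coef d n / 2 * (N : ℝ) ^ 2 * Real.log β| ≤ d * (N : ℝ) ^ 2 / 2 * Real.log β := by
    rw [abs_of_nonneg (by have := coef_nonneg (d := d) n; positivity)]
    have := coef_le (d := d) n
    have hN : (0 : ℝ) ≤ (N : ℝ) ^ 2 * Real.log β := by positivity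
    calc coef d n / 2 * (N : ℝ) ^ 2 * Real.log β = coef d n / 2 * ((N : ℝ) ^ 2 * Real.log β) := by ring
      _ ≤ d / 2 * ((N : ℝ) ^ 2 * Real.log β) := by gcongr
      _ = d * (N : ℝ) ^ 2 / 2 * Real.log β := by ring
  calc |T d N n β| ≤ |F d N n β| + |coef d n / 2 * (N : ℝ) ^ 2 * Real.log β| := abs_add_le _ _
    _ ≤ C71 d N * Real.log β + d * (N : ℝ) ^ 2 / 2 * Real.log β := add_le_add h1 h2
    _ = (C71 d N + d * (N : ℝ) ^ 2 / 2) * Real.log β := by ring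


/-! ### Lemma 17.2 in free-energy form -/

/-- **Lemma 17.2 (F-form)**: for `β ≥ 2`, `n ≥ 1` and `ρ₀ ≤ 1/8`,
`T(B_n, β) ≤ G(n) + log 2/n^d + 67 β N (2ρ₀)³ d²`. [cite: arXiv160201222, Lemma 17.2] -/
theorem T_le_G_add {β : ℝ} (hβ : 2 ≤ β) {n : ℕ} (hn : 1 ≤ n) (hρ : rho0 (C71 d N) d n β ≤ 1 / 8) :
    T d N n β ≤ G d N n + Real.log 2 / (n : ℝ) ^ d +
      67 * β * N * (2 * rho0 (C71 d N) d n β) ^ 3 * ((d : ℝ) * d) := by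
  have h := logZ_le (d := d) (N := N) n hβ hρ
  have hnd : (0 : ℝ) < (n : ℝ) ^ d := by positivity
  have hPn : (Pn d n : ℝ) ≤ d * d * (n : ℝ) ^ d := by exact_mod_cast card_plaquettesIn_le (d := d) n
  set E : ℝ := 67 * β * N * (2 * rho0 (C71 d N) d n β) ^ 3 with hE
  have hE0 : 0 ≤ E := by have := rho0_nonneg (C71 d N) d n β; rw [hE]; positivity
  have hEP : E * Pn d n ≤ E * (d * d * (n : ℝ) ^ d) := mul_le_mul_of_nonneg_left hPn hE0
  have eq1 : T d N n β = (logZ d N n β + D₁ d n / 2 * (N : ℝ) ^ 2 * Real.log β) / (n : ℝ) ^ d := by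
    unfold T; rw [F_eq, coef]; field_simp
  have eq2 : G d N n + Real.log 2 / (n : ℝ) ^ d + E * ((d : ℝ) * d) =
      (D₁ d n * Real.log ((haarChartConst N : ℝ≥0) : ℝ) + (N : ℝ) ^ 2 * logZM d n + Real.log 2 +
        E * (d * d * (n : ℝ) ^ d)) / (n : ℝ) ^ d := by
    unfold G; rw [coef]; field_simp
  rw [eq1, eq2]
  refine div_le_div_of_nonneg_right ?_ hnd.le
  have hsq : (N : ℝ) ^ 2 = N * N := sq _
  rw [hsq]
  have h' : 67 * β * ↑N * (2 * rho0 (C71 d N) d n β) ^ 3 * ↑(Pn d n) = E * Pn d n := by rw [hE]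
  rw [h'] at h
  linarith

/-! ### Lemma 17.3 in cube form -/

/-- Bernoulli: `1 - x^d ≤ d (1 - x)` for `0 ≤ x`. [folklore] -/
theorem one_sub_pow_le' {x : ℝ} (hx : 0 ≤ x) (d : ℕ) : 1 - x ^ d ≤ d * (1 - x) := by
  have h := one_add_mul_le_pow (show (-2 : ℝ) ≤ x - 1 by linarith) d
  rw [add_sub_cancel] at h
  linarith

/-- **Lemma 17.3 (cube form)**: for `β ≥ 0`, `1 ≤ m`, `m + 1 ≤ n` and `k = ⌊n/(m+1)⌋`,
`F(B_n, β) ≤ (km/n)^d F(B_m, β)` (the cube `B_n` contains `k^d` edge-disjoint translates of the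
box of plaquettes based in `B_m`; weights `≤ 1`). [cite: arXiv160201222, Lemma 17.3] -/
theorem F_le_mul_F {β : ℝ} (hβ : 0 ≤ β) {m n : ℕ} (hm : 1 ≤ m) (hmn : m + 1 ≤ n) :
    F d N n β ≤ (((n / (m + 1) : ℕ) : ℝ) * m / n) ^ d * F d N m β := by
  have hρ : Continuous (ι) := continuous_unitaryFundamentalRep (Fin N) ℂ
  set k := n / (m + 1) with hk
  have hkn : (m + 1) * k ≤ n := Nat.mul_div_le n (m + 1)
  have h1 : logZ d N n β ≤ logZ d N ((m + 1) * k) β := logZ_anti hβ hkn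
  have h2 : logZ d N ((m + 1) * k) β ≤ (k : ℝ) ^ d * logZ d N m β :=
    log_Z_mul_le (d := d) (ι) hρ re_trace_rep_le hβ m k
  have hn1 : 1 ≤ n := by omega
  have hn : (0 : ℝ) < (n : ℝ) ^ d := by positivity
  have hm' : (0 : ℝ) < (m : ℝ) ^ d := by positivity
  rw [F_eq, F_eq]
  calc logZ d N n β / (n : ℝ) ^ d ≤ (k : ℝ) ^ d * logZ d N m β / (n : ℝ) ^ d :=
        div_le_div_of_nonneg_right (h1.trans h2) hn.le
    _ = ((k : ℝ) * m / n) ^ d * (logZ d N m β / (m : ℝ) ^ d) := by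
        rw [div_pow, mul_pow]; field_simp

/-- The factor of Lemma 17.3 lies in `[0, 1]`. [folklore] -/
theorem theta_mem {m n : ℕ} (hmn : m + 1 ≤ n) :
    0 ≤ (((n / (m + 1) : ℕ) : ℝ) * m / n) ∧ (((n / (m + 1) : ℕ) : ℝ) * m / n) ≤ 1 := by
  set k := n / (m + 1) with hk
  have hkn : (m + 1) * k ≤ n := Nat.mul_div_le n (m + 1)
  have hn1 : 1 ≤ n := by omega
  have hn : (0 : ℝ) < n := by exact_mod_cast hn1
  refine ⟨by positivity, ?_⟩
  rw [div_le_one hn]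
  have : (k : ℝ) * m ≤ (m + 1) * k := by nlinarith [(Nat.cast_nonneg k : (0 : ℝ) ≤ k)]
  exact this.trans (by exact_mod_cast hkn)

/-- The factor of Lemma 17.3 is close to one: `1 - (km/n) ≤ m/n + 1/(m+1)`, hence
`1 - (km/n)^d ≤ d (m/n + 1/(m+1))`. [cite: arXiv160201222, Lemma 17.3] -/
theorem one_sub_theta_pow_le {m n : ℕ} (hmn : m + 1 ≤ n) :
    1 - (((n / (m + 1) : ℕ) : ℝ) * m / n) ^ d ≤ d * ((m : ℝ) / n + 1 / ((m : ℝ) + 1)) := by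
  set k := n / (m + 1) with hk
  have hn1 : 1 ≤ n := by omega
  have hn : (0 : ℝ) < n := by exact_mod_cast hn1
  have hm1 : (0 : ℝ) < (m : ℝ) + 1 := by positivity
  -- `(m+1)(k+1) > n`
  have hlt : n < (m + 1) * (k + 1) := by
    have := Nat.lt_div_mul_add (a := n) (b := m + 1) (by omega)
    rw [hk]; linarith [Nat.div_mul_le_self n (m+1), this]
  have hlt' : (n : ℝ) < ((m : ℝ) + 1) * ((k : ℝ) + 1) := by exact_mod_cast hlt
  have hx := (theta_mem (m := m) (n := n) hmn)
  refine (one_sub_pow_le' hx.1 d).trans ?_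
  refine mul_le_mul_of_nonneg_left ?_ (Nat.cast_nonneg d)
  have hm0 : (0 : ℝ) ≤ m := Nat.cast_nonneg m
  have hkey' : (n : ℝ) * m ≤ ((m : ℝ) + 1) * ((k : ℝ) + 1) * m := mul_le_mul_of_nonneg_right hlt'.le hm0
  have hkey'' := mul_le_mul_of_nonneg_left hkey' hn.le
  rw [show (1 : ℝ) - (k : ℝ) * m / n = ((n : ℝ) - k * m) / n by field_simp]
  rw [div_add_div _ _ hn.ne' hm1.ne', div_le_div_iff₀ hn (by positivity)]
  nlinarith [hkey'']

/-! ### Monotonicity in F-form and Lemma 17.5 in cube form -/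

/-- `F(B_n, β) ≥ (n'/n)^d F(B_{n'}, β)` for `1 ≤ n ≤ n'`, `β ≥ 0`. [cite: arXiv160201222, Lemma 17.3 (proof)] -/
theorem mul_F_le_F {β : ℝ} (hβ : 0 ≤ β) {n n' : ℕ} (hn : 1 ≤ n) (h : n ≤ n') :
    ((n' : ℝ) / n) ^ d * F d N n' β ≤ F d N n β := by
  have h1 : logZ d N n' β ≤ logZ d N n β := logZ_anti hβ h
  have hn0 : (0 : ℝ) < (n : ℝ) ^ d := by positivity
  have hn1' : 1 ≤ n' := hn.trans h
  have hn' : (0 : ℝ) < (n' : ℝ) ^ d := by positivity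
  rw [F_eq, F_eq]
  calc ((n' : ℝ) / n) ^ d * (logZ d N n' β / (n' : ℝ) ^ d) = logZ d N n' β / (n : ℝ) ^ d := by
        rw [div_pow]; field_simp
    _ ≤ logZ d N n β / (n : ℝ) ^ d := div_le_div_of_nonneg_right h1 hn0.le

/-- **Lemma 17.5 (cube form, lower half)**: for `β ≥ 0`, `1 ≤ n''`, `n'' + 1 ≤ n` and
`k = ⌊n/(n''+1)⌋ + 1` (so that `B_n ⊆ B_{(n''+1)k}`),
`F(B_n, β) ≥ (k n''/n)^d F(B_{n''}, β) - 2Nβ · #planes · (k/n)^d (2 n''^{d-1} + (n''+1)^d - n''^d)`. [cite: arXiv160201222, Lemma 17.5] -/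
theorem F_ge_of_ge {β : ℝ} (hβ : 0 ≤ β) {n'' n : ℕ} (hn'' : 1 ≤ n'') (hn : n'' + 1 ≤ n) :
    ((((n / (n'' + 1) : ℕ) : ℝ) + 1) * n'' / n) ^ d * F d N n'' β -
        2 * N * β * Fintype.card {q : Fin d × Fin d // q.1 < q.2} *
          ((((n / (n'' + 1) : ℕ) : ℝ) + 1) / n) ^ d *
            (2 * (n'' : ℝ) ^ (d - 1) + (((n'' : ℝ) + 1) ^ d - (n'' : ℝ) ^ d)) ≤
      F d N n β := by
  have hρ : Continuous (ι) := continuous_unitaryFundamentalRep (Fin N) ℂ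
  set k := n / (n'' + 1) + 1 with hk
  set D : ℕ := Fintype.card {q : Fin d × Fin d // q.1 < q.2} with hD
  have hnk : n ≤ (n'' + 1) * k := by
    have := Nat.lt_div_mul_add (a := n) (b := n'' + 1) (by omega)
    rw [hk, Nat.mul_add, mul_one, Nat.mul_comm]; exact this.le
  have h1 : logZ d N ((n'' + 1) * k) β ≤ logZ d N n β := logZ_anti hβ hnk
  have h2 := le_log_Z_mul (d := d) (ι) hρ (M := N) abs_re_trace_rep_le β n'' k
  rw [abs_of_nonneg hβ] at h2
  have h2' : (k : ℝ) ^ d * (logZ d N n'' β - β * (N + N) * (2 * D * (n'' : ℝ) ^ (d - 1))) -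
      β * (N + N) * (D * ((k : ℝ) ^ d * (((n'' + 1 : ℕ) : ℝ) ^ d - (n'' : ℝ) ^ d))) ≤
        logZ d N ((n'' + 1) * k) β := h2
  have hn1 : 1 ≤ n := by omega
  have hn0 : (0 : ℝ) < (n : ℝ) ^ d := by positivity
  have hn''0 : (0 : ℝ) < (n'' : ℝ) ^ d := by positivity
  rw [F_eq, F_eq]
  have hkey : (k : ℝ) ^ d * logZ d N n'' β -
      2 * N * β * D * (k : ℝ) ^ d * (2 * (n'' : ℝ) ^ (d - 1) + (((n'' : ℝ) + 1) ^ d - (n'' : ℝ) ^ d)) ≤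
        logZ d N n β := by
    have : (((n'' + 1 : ℕ) : ℝ)) = (n'' : ℝ) + 1 := by push_cast; ring
    rw [this] at h2'
    linarith
  have eq : (((k : ℝ)) * n'' / n) ^ d * (logZ d N n'' β / (n'' : ℝ) ^ d) -
      2 * N * β * D * ((k : ℝ) / n) ^ d * (2 * (n'' : ℝ) ^ (d - 1) + (((n'' : ℝ) + 1) ^ d - (n'' : ℝ) ^ d)) =
      ((k : ℝ) ^ d * logZ d N n'' β -
        2 * N * β * D * (k : ℝ) ^ d * (2 * (n'' : ℝ) ^ (d - 1) + (((n'' : ℝ) + 1) ^ d - (n'' : ℝ) ^ d))) / (n : ℝ) ^ d := by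
    rw [div_pow, div_pow, mul_pow]; field_simp
  have hk' : ((((n / (n'' + 1) : ℕ) : ℝ) + 1)) = (k : ℝ) := by rw [hk]; push_cast; ring
  rw [hk', eq]
  exact div_le_div_of_nonneg_right hkey hn0.le


/-! ### Lemma 17.6 in free-energy form -/

/-- Sites of `ℤ^d`. -/
local notation "ZSite" => Literature.Probability.LatticeModels.Site

/-- **The Gaussian lower bound in F-form** (core of Lemma 17.6): for `β ≥ 2`, `N ≥ 1`, `n ≥ 1`,
`0 < r ≤ 1/2` and `0 < L ≤ τ_n(|y_e| ≤ √β r/N ∀ e)`,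
`T(B_n, β) ≥ G(n) - (coef(n) N² log κ(r) + 67 β N r³ d² - N² log L / n^d)`. [cite: arXiv160201222, Lemma 17.6] -/
theorem G_sub_le_T {β : ℝ} (hβ : 2 ≤ β) (hN : 1 ≤ N) {n : ℕ} (hn : 1 ≤ n) {r : ℝ} (hr : 0 < r)
    (hr2 : r ≤ 1 / 2) {L : ℝ≥0∞} (hL0 : L ≠ 0)
    (hL : L ≤ τ (pinI (d := d)) (0 : ZSite d) n {y | ∀ e, |y e| ≤ Real.sqrt β * r / N}) :
    G d N n - (coef d n * (N : ℝ) ^ 2 * Real.log (κ r) + 67 * β * N * r ^ 3 * ((d : ℝ) * d) -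
        (N : ℝ) ^ 2 * (Real.log L.toReal / (n : ℝ) ^ d)) ≤ T d N n β := by
  have h := le_logZ (d := d) (N := N) n hβ hN hr hr2 hL0 hL
  have hnd : (0 : ℝ) < (n : ℝ) ^ d := by positivity
  have hPn : (Pn d n : ℝ) ≤ d * d * (n : ℝ) ^ d := by exact_mod_cast card_plaquettesIn_le (d := d) n
  have hβ0 : 0 ≤ β := by linarith
  set E : ℝ := 67 * β * N * r ^ 3 with hE
  have hE0 : 0 ≤ E := by rw [hE]; positivity
  have hEP : E * Pn d n ≤ E * (d * d * (n : ℝ) ^ d) := mul_le_mul_of_nonneg_left hPn hE0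
  have eq1 : T d N n β = (logZ d N n β + D₁ d n / 2 * (N : ℝ) ^ 2 * Real.log β) / (n : ℝ) ^ d := by
    unfold T; rw [F_eq, coef]; field_simp
  have eq2 : G d N n - (coef d n * (N : ℝ) ^ 2 * Real.log (κ r) + E * ((d : ℝ) * d) -
      (N : ℝ) ^ 2 * (Real.log L.toReal / (n : ℝ) ^ d)) =
      (D₁ d n * Real.log ((haarChartConst N : ℝ≥0) : ℝ) + (N : ℝ) ^ 2 * logZM d n -
        (D₁ d n * (N : ℝ) ^ 2 * Real.log (κ r) + E * (d * d * (n : ℝ) ^ d) - (N : ℝ) ^ 2 * Real.log L.toReal)) /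
        (n : ℝ) ^ d := by
    unfold G; rw [coef]; field_simp
  rw [eq1, eq2]
  refine div_le_div_of_nonneg_right ?_ hnd.le
  have hsq : (N : ℝ) ^ 2 = N * N := sq _
  rw [hsq]
  have h' : 67 * β * ↑N * r ^ 3 * ↑(Pn d n) = E * Pn d n := by rw [hE]
  rw [h'] at h
  linarith

/-! ### The small-`n` Gaussian input: `τ_n(‖y‖_∞ ≤ x) ≥ 1/2` for `x ≥ R_z(n)` -/

variable (d) in
/-- The radius `R_z(n) = (2 log(4dn^d + 4)/c_n)^{1/2}` beyond which the sup-norm of `τ_n` exceeds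
it with probability at most `1/2` (the union bound `gaussmax`). [cite: arXiv160201222, §12 (`gaussmax`), Thm. 14.2] -/
def Rz (n : ℕ) : ℝ := Real.sqrt (2 * Real.log (4 * ((d : ℝ) * (n : ℝ) ^ d) + 4) / cLow d n)

/-- `R_z ≥ 0`. [folklore] -/
theorem Rz_nonneg (n : ℕ) : 0 ≤ Rz d n := Real.sqrt_nonneg _

/-- The number of free edges of `B_n` is at most `d n^d`. [folklore] -/
theorem card_free_le (n : ℕ) : (Fintype.card (Free (pinI (d := d)) (0 : ZSite d) n) : ℝ) ≤ d * (n : ℝ) ^ d := by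
  have h1 : Fintype.card (Free (pinI (d := d)) (0 : ZSite d) n) = D₁ d n :=
    (Fintype.card_congr (idx (d := d) (n := n))).symm
  rw [h1, D₁_eq_card]
  exact_mod_cast card_freeEdges_le (d := d) n

/-- **Sup-norm of the axial-gauge lattice Maxwell field**: `τ_n(|y_e| ≤ x ∀ e) ≥ 1/2` for
`x ≥ R_z(n)`. [cite: arXiv160201222, §12 (`gaussmax`)] -/
theorem half_le_τ {n : ℕ} {x : ℝ} (hx : Rz d n ≤ x) :
    (1 / 2 : ℝ≥0∞) ≤ τ (pinI (d := d)) (0 : ZSite d) n {y | ∀ e, |y e| ≤ x} := by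
  have hx0 : 0 ≤ x := (Rz_nonneg n).trans hx
  have h := multivariateGaussian_real_forall_abs_le_ge (posDef_Qmat (hpinI (d := d) n)) (cLow_pos (d := d) (n := n))
    (fun v => (form_bounds (hpinI (d := d) n) v).1) (fun v => (form_bounds (hpinI (d := d) n) v).2) hx0
  set card : ℝ := (Fintype.card (Free (pinI (d := d)) (0 : ZSite d) n) : ℝ) with hcard
  -- `2 card e^{-c x²/2} ≤ 1/2`
  have hc := cLow_pos (d := d) (n := n)
  have hA : 0 < 4 * ((d : ℝ) * (n : ℝ) ^ d) + 4 := by positivity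
  have hexp : Real.exp (-(cLow d n * x ^ 2 / 2)) ≤ (4 * ((d : ℝ) * (n : ℝ) ^ d) + 4)⁻¹ := by
    rw [← Real.exp_log (inv_pos.2 hA)]
    apply Real.exp_le_exp.2
    rw [Real.log_inv, neg_le_neg_iff]
    -- `log A ≤ c x²/2` from `x ≥ Rz`
    have h1 : Rz d n ^ 2 = 2 * Real.log (4 * ((d : ℝ) * (n : ℝ) ^ d) + 4) / cLow d n := by
      rw [Rz, Real.sq_sqrt]
      have hdn : (0 : ℝ) ≤ 4 * ((d : ℝ) * (n : ℝ) ^ d) := by positivity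
      exact div_nonneg (mul_nonneg zero_le_two (Real.log_nonneg (by linarith))) hc.le
    have h2 : Rz d n ^ 2 ≤ x ^ 2 := pow_le_pow_left₀ (Rz_nonneg n) hx 2
    rw [h1, div_le_iff₀ hc] at h2
    linarith
  have hbound : 2 * card * Real.exp (-(cLow d n * x ^ 2 / 2)) ≤ 1 / 2 := by
    have hcd : card ≤ d * (n : ℝ) ^ d := card_free_le n
    have hcard0 : 0 ≤ card := by rw [hcard]; positivity
    calc 2 * card * Real.exp (-(cLow d n * x ^ 2 / 2)) ≤ 2 * card * (4 * ((d : ℝ) * (n : ℝ) ^ d) + 4)⁻¹ := by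
          gcongr
      _ ≤ 1 / 2 := by
          rw [← div_eq_mul_inv, div_le_iff₀ hA]; linarith
  have hreal : (1 / 2 : ℝ) ≤ (τ (pinI (d := d)) (0 : ZSite d) n).real {y | ∀ e, |y e| ≤ x} := by
    have := h; unfold τ; linarith
  rw [measureReal_def] at hreal
  calc (1 / 2 : ℝ≥0∞) = ENNReal.ofReal (1 / 2) := by
        rw [ENNReal.ofReal_div_of_pos two_pos]; simp
    _ ≤ ENNReal.ofReal ((τ (pinI (d := d)) (0 : ZSite d) n {y | ∀ e, |y e| ≤ x}).toReal) :=
        ENNReal.ofReal_le_ofReal hreal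
    _ = τ (pinI (d := d)) (0 : ZSite d) n {y | ∀ e, |y e| ≤ x} := ENNReal.ofReal_toReal (measure_ne_top _ _)

/-- **Lower bound, small `n`**: for `β ≥ 2`, `N ≥ 1`, `n ≥ 1`, `0 < r ≤ 1/2` and `R_z(n) ≤ √β r/N`,
`T(B_n, β) ≥ G(n) - (coef(n) N² log κ(r) + 67 β N r³ d² + N² log 2 / n^d)`. [cite: arXiv160201222, Lemma 17.6] -/
theorem G_sub_le_T_small {β : ℝ} (hβ : 2 ≤ β) (hN : 1 ≤ N) {n : ℕ} (hn : 1 ≤ n) {r : ℝ} (hr : 0 < r)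
    (hr2 : r ≤ 1 / 2) (hx : Rz d n ≤ Real.sqrt β * r / N) :
    G d N n - (coef d n * (N : ℝ) ^ 2 * Real.log (κ r) + 67 * β * N * r ^ 3 * ((d : ℝ) * d) +
        (N : ℝ) ^ 2 * (Real.log 2 / (n : ℝ) ^ d)) ≤ T d N n β := by
  have h := G_sub_le_T (d := d) hβ hN hn hr hr2 (L := 1 / 2) (by norm_num) (half_le_τ hx)
  have hlog : Real.log ((1 / 2 : ℝ≥0∞)).toReal = -Real.log 2 := by
    rw [ENNReal.toReal_div, ENNReal.toReal_one, ENNReal.toReal_ofNat, one_div, Real.log_inv]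
  rw [hlog] at h
  have : -((N : ℝ) ^ 2 * (-Real.log 2 / (n : ℝ) ^ d)) = (N : ℝ) ^ 2 * (Real.log 2 / (n : ℝ) ^ d) := by ring
  linarith


/-! ### The Theorem-14.3 input for the special side lengths `n = ρ(m-1)+1` -/

variable (d) in
/-- A bound for the per-edge cost `-log(2η (c_n/2π)^{1/2} e^{-C_n η²/2})` of Theorems 14.1/14.3 at
`η = n^{-d}`: `B(n) = (2d+1) log n + log d + 8d² + 2`. [cite: arXiv160201222, Thm. 14.1] -/
def Bcost (n : ℕ) : ℝ := (2 * d + 1) * Real.log n + (Real.log d + 8 * (d : ℝ) ^ 2 + 2)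

/-- `B(n) ≥ 0` for `n, d ≥ 1`. [folklore] -/
theorem Bcost_nonneg (hd : 1 ≤ d) {n : ℕ} (hn : 1 ≤ n) : 0 ≤ Bcost d n := by
  unfold Bcost
  have h1 : 0 ≤ Real.log n := Real.log_nonneg (by exact_mod_cast hn)
  have h2 : 0 ≤ Real.log d := Real.log_nonneg (by exact_mod_cast hd)
  positivity

/-- The per-edge factor of Theorem 14.1 at `η = n^{-d}` is at least `e^{-B(n)}`. [cite: arXiv160201222, Thm. 14.1] -/
theorem neg_Bcost_le_log_base (hd : 1 ≤ d) {n : ℕ} (hn : 1 ≤ n) :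
    -Bcost d n ≤ Real.log (2 * ((n : ℝ) ^ d)⁻¹ * (Real.sqrt (cLow d n) / Real.sqrt (2 * Real.pi)) *
      Real.exp (-(cUp d n * (((n : ℝ) ^ d)⁻¹) ^ 2 / 2))) := by
  have hn0 : (0 : ℝ) < n := by exact_mod_cast hn
  have hnd : (0 : ℝ) < (n : ℝ) ^ d := by positivity
  have hd0 : (0 : ℝ) < d := by exact_mod_cast hd
  have hc := cLow_pos (d := d) (n := n)
  have hC := cUp_pos (d := d) (n := n)
  have hπ : 0 < 2 * Real.pi := by positivity
  have hlogn : 0 ≤ Real.log n := Real.log_nonneg (by exact_mod_cast hn)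
  have hlogd : 0 ≤ Real.log d := Real.log_nonneg (by exact_mod_cast hd)
  rw [Real.log_mul (by positivity) (Real.exp_pos _).ne', Real.log_exp,
    Real.log_mul (by positivity) (by positivity), Real.log_mul two_ne_zero (by positivity),
    Real.log_div (Real.sqrt_pos.2 hc).ne' (Real.sqrt_pos.2 hπ).ne', Real.log_sqrt hc.le, Real.log_sqrt hπ.le,
    Real.log_inv, Real.log_pow]
  -- bounds on the pieces
  have h1 : Real.log (2 * Real.pi) ≤ 2 := by
    have hπ3 := Real.pi_lt_d2  -- π < 3.15
    have he : (2.7182818283 : ℝ) < Real.exp 1 := Real.exp_one_gt_d9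
    have he2 : Real.exp 2 = Real.exp 1 * Real.exp 1 := by rw [← Real.exp_add]; norm_num
    calc Real.log (2 * Real.pi) ≤ Real.log (Real.exp 2) := Real.log_le_log hπ (by rw [he2]; nlinarith)
      _ = 2 := Real.log_exp 2
  have h2 : -Real.log (cLow d n) ≤ Real.log 2 + 2 * Real.log d + (d + 1) * Real.log n := by
    rw [cLow, Real.log_inv, neg_neg]
    have hle : (d : ℝ) ^ 2 * (n : ℝ) ^ (d + 1) + 1 ≤ 2 * ((d : ℝ) ^ 2 * (n : ℝ) ^ (d + 1)) := by
      have : (1 : ℝ) ≤ (d : ℝ) ^ 2 * (n : ℝ) ^ (d + 1) := by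
        have hd1 : (1 : ℝ) ≤ d := by exact_mod_cast hd
        have h1' : (1 : ℝ) ≤ (d : ℝ) ^ 2 := by nlinarith
        have h2' : (1 : ℝ) ≤ (n : ℝ) ^ (d + 1) := one_le_pow₀ (by exact_mod_cast hn)
        nlinarith
      linarith
    calc Real.log ((d : ℝ) ^ 2 * (n : ℝ) ^ (d + 1) + 1) ≤ Real.log (2 * ((d : ℝ) ^ 2 * (n : ℝ) ^ (d + 1))) :=
          Real.log_le_log (by positivity) hle
      _ = Real.log 2 + 2 * Real.log d + (d + 1) * Real.log n := by
          rw [Real.log_mul two_ne_zero (by positivity), Real.log_mul (by positivity) (by positivity),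
            Real.log_pow, Real.log_pow]; push_cast; ring
  have h3 : cUp d n * (((n : ℝ) ^ d)⁻¹) ^ 2 / 2 ≤ 8 * (d : ℝ) ^ 2 + 1 / 2 := by
    have hP : (cUp d n : ℝ) ≤ 16 * ((d : ℝ) * d * (n : ℝ) ^ d) + 1 := by
      have h' : (#(plaquettesIn (halfOpenBox d n)) : ℝ) ≤ d * d * (n : ℝ) ^ d := by
        exact_mod_cast card_plaquettesIn_le (d := d) n
      unfold cUp; linarith
    have hnd1 : (1 : ℝ) ≤ (n : ℝ) ^ d := one_le_pow₀ (by exact_mod_cast hn)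
    generalize hM : (n : ℝ) ^ d = M at hP hnd1 ⊢
    have hM0 : 0 < M := by linarith
    have hCle : cUp d n ≤ (16 * (d : ℝ) ^ 2 + 1) * M := by nlinarith
    calc cUp d n * (M⁻¹) ^ 2 / 2 ≤ (16 * (d : ℝ) ^ 2 + 1) * M * (M⁻¹) ^ 2 / 2 := by gcongr
      _ = (16 * (d : ℝ) ^ 2 + 1) / M / 2 := by field_simp
      _ ≤ (16 * (d : ℝ) ^ 2 + 1) / 1 / 2 := by gcongr
      _ = 8 * (d : ℝ) ^ 2 + 1 / 2 := by ring
  have hlog2 : Real.log 2 ≤ 1 := by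
    have := Real.log_two_lt_d9; linarith
  have hlog2' : 0 ≤ Real.log 2 := Real.log_nonneg one_le_two
  have hdl : 0 ≤ (d : ℝ) * Real.log n := by positivity
  unfold Bcost
  generalize cUp d n * ((n : ℝ) ^ d)⁻¹ ^ 2 / 2 = X at h3 ⊢
  generalize Real.log (cLow d n) = Y at h2 ⊢
  generalize Real.log (2 * Real.pi) = P at h1 ⊢
  linarith only [h1, h2, h3, hlog2, hlog2', hdl, hlogn, hlogd]

/-- **Lower bound, special `n = ρ(m-1)+1`** (Lemma 17.6 with Theorem 14.3 supplying the Gaussian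
small-ball probability): for `β ≥ 2`, `N, d ≥ 1`, `m ≥ 2`, `ρ ≥ 1`, `0 < r ≤ 1/2`, and with
`η = n^{-d}` satisfying `η ≤ √β r/N`, `R₀(m, η) ≤ √β r/N`,
`T(B_n, β) ≥ G(n) - (coef(n) N² log κ(r) + 67βNr³d² + N² (log 2/(m-1)^d + (4d²/(m-1)) B(n)))`. [cite: arXiv160201222, Lemma 17.6, Thm. 14.3] -/
theorem G_sub_le_T_special {β : ℝ} (hβ : 2 ≤ β) (hN : 1 ≤ N) (hd : 1 ≤ d) {m ρ : ℕ} (hm : 2 ≤ m)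
    (hρ : 1 ≤ ρ) {r : ℝ} (hr : 0 < r) (hr2 : r ≤ 1 / 2)
    (hη : ((fineN m ρ : ℝ) ^ d)⁻¹ ≤ Real.sqrt β * r / N)
    (hR : R0 d m (((fineN m ρ : ℝ) ^ d)⁻¹) ≤ Real.sqrt β * r / N) :
    G d N (fineN m ρ) - (coef d (fineN m ρ) * (N : ℝ) ^ 2 * Real.log (κ r) +
        67 * β * N * r ^ 3 * ((d : ℝ) * d) +
        (N : ℝ) ^ 2 * (Real.log 2 / ((m : ℝ) - 1) ^ d + 4 * (d : ℝ) ^ 2 / ((m : ℝ) - 1) * Bcost d (fineN m ρ))) ≤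
      T d N (fineN m ρ) β := by
  set n := fineN m ρ with hn
  have hn1 : 1 ≤ n := by rw [hn, fineN]; omega
  have hn0 : (0 : ℝ) < n := by exact_mod_cast hn1
  have hnd : (0 : ℝ) < (n : ℝ) ^ d := by positivity
  set η : ℝ := ((n : ℝ) ^ d)⁻¹ with hηdef
  have hη0 : 0 < η := inv_pos.2 hnd
  set R' : ℝ := Real.sqrt β * r / N with hR'
  -- Theorem 14.3
  have h143 := theorem_14_3 (d := d) (m := m) (r := ρ) hm hη0 hη hR (fun b _ => Rθ_le_R0 b η)
  set base : ℝ := 2 * η * (Real.sqrt (cLow d n) / Real.sqrt (2 * Real.pi)) * Real.exp (-(cUp d n * η ^ 2 / 2))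
    with hbase
  have hbase0 : 0 < base := by
    rw [hbase]; have := cLow_pos (d := d) (n := n); positivity
  set A : ℕ := (Abdry (d := d) m ρ).card with hA
  set L : ℝ≥0∞ := (2 ^ (ρ ^ d))⁻¹ * ENNReal.ofReal (base ^ A) with hL
  have h2ne0 : (2 : ℝ≥0∞) ^ (ρ ^ d) ≠ 0 := pow_ne_zero _ two_ne_zero
  have h2netop : (2 : ℝ≥0∞) ^ (ρ ^ d) ≠ ∞ := ENNReal.pow_ne_top ENNReal.ofNat_ne_top
  have hLle : L ≤ τ (pinI (d := d)) (0 : ZSite d) n {y | ∀ e, |y e| ≤ R'} := by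
    rw [hL, ENNReal.inv_mul_le_iff h2ne0 h2netop]
    exact h143
  have hL0 : L ≠ 0 := by
    rw [hL]; refine mul_ne_zero (ENNReal.inv_ne_zero.2 h2netop) ?_
    rw [ne_eq, ENNReal.ofReal_eq_zero, not_le]; positivity
  have hmain := G_sub_le_T (d := d) hβ hN hn1 hr hr2 hL0 hLle
  -- `log L.toReal = -ρ^d log 2 + A log base`
  have hLreal : L.toReal = ((2 : ℝ) ^ (ρ ^ d))⁻¹ * base ^ A := by
    rw [hL, ENNReal.toReal_mul, ENNReal.toReal_inv, ENNReal.toReal_pow, ENNReal.toReal_ofNat,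
      ENNReal.toReal_ofReal (by positivity)]
  have hlogL : Real.log L.toReal = -(ρ ^ d * Real.log 2) + A * Real.log base := by
    rw [hLreal, Real.log_mul (by positivity) (by positivity), Real.log_inv, Real.log_pow, Real.log_pow]; push_cast; ring
  -- the cost bound
  have hB := neg_Bcost_le_log_base (d := d) hd hn1
  have hB0 := Bcost_nonneg (d := d) hd hn1
  have hm1 : (0 : ℝ) < (m : ℝ) - 1 := by
    have : (2 : ℝ) ≤ m := by exact_mod_cast hm
    linarith
  have hAle : (A : ℝ) ≤ 4 * (d : ℝ) ^ 2 * (n : ℝ) ^ d / ((m : ℝ) - 1) := card_Abdry_le_real hm hρ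
  have hρn : (ρ : ℝ) * ((m : ℝ) - 1) ≤ n := by
    have : (n : ℝ) = ρ * ((m : ℝ) - 1) + 1 := by
      rw [hn, fineN]; push_cast; rw [Nat.cast_sub (by omega)]; push_cast; ring
    linarith
  have hρd : (ρ : ℝ) ^ d * ((m : ℝ) - 1) ^ d ≤ (n : ℝ) ^ d := by
    rw [← mul_pow]; exact pow_le_pow_left₀ (by positivity) hρn d
  -- `-log L/n^d ≤ log 2/(m-1)^d + 4d² B/(m-1)`
  have hkey : -(Real.log L.toReal / (n : ℝ) ^ d) ≤
      Real.log 2 / ((m : ℝ) - 1) ^ d + 4 * (d : ℝ) ^ 2 / ((m : ℝ) - 1) * Bcost d n := by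
    rw [hlogL]
    have hlog2 : 0 ≤ Real.log 2 := Real.log_nonneg one_le_two
    have t1 : (ρ : ℝ) ^ d * Real.log 2 / (n : ℝ) ^ d ≤ Real.log 2 / ((m : ℝ) - 1) ^ d := by
      rw [div_le_div_iff₀ hnd (by positivity)]
      nlinarith
    have t2 : -((A : ℝ) * Real.log base) / (n : ℝ) ^ d ≤ 4 * (d : ℝ) ^ 2 / ((m : ℝ) - 1) * Bcost d n := by
      have hA0 : (0 : ℝ) ≤ (A : ℝ) := Nat.cast_nonneg A
      have hAB : -((A : ℝ) * Real.log base) ≤ A * Bcost d n := by nlinarith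
      calc -((A : ℝ) * Real.log base) / (n : ℝ) ^ d ≤ A * Bcost d n / (n : ℝ) ^ d :=
            div_le_div_of_nonneg_right hAB hnd.le
        _ ≤ (4 * (d : ℝ) ^ 2 * (n : ℝ) ^ d / ((m : ℝ) - 1)) * Bcost d n / (n : ℝ) ^ d := by
            gcongr
        _ = 4 * (d : ℝ) ^ 2 / ((m : ℝ) - 1) * Bcost d n := by field_simp
    have : -((-(↑ρ ^ d * Real.log 2) + ↑A * Real.log base) / (n : ℝ) ^ d) =
        (ρ : ℝ) ^ d * Real.log 2 / (n : ℝ) ^ d + -((A : ℝ) * Real.log base) / (n : ℝ) ^ d := by ring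
    rw [this]; exact add_le_add t1 t2
  have hN2 : (0 : ℝ) ≤ (N : ℝ) ^ 2 := by positivity
  have hfin := mul_le_mul_of_nonneg_left hkey hN2
  linarith only [hmain, hfin]

end ChatterjeeJointLimit

end Literature.MathematicalPhysics.QuantumFieldTheory
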